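import Literature.Barriers.RiemannHypothesis.TuranPartialSumsCertified
import Literature.Barriers.RiemannHypothesis.TuranPartialSumsShiftHolds
import Literature.Barriers.RiemannHypothesis.TuranPartialSumsShiftLowHolds
import HarnessLib

/-!
# `TuranPartialSums` holds: every section `ζ_N`, `N ≥ 29`, has a zero with `Re s > 1`

Barrier catalogue `Literature/Barriers/RiemannHypothesis/` (D-0021). Proofs only (no definitions, no
named facts): the discharge of the named fact `Literature.Barriers.RiemannHypothesis.TuranPartialSums`
of `TuranPartialSums.lean` — Platt–Trudgian 2016, Theorem 1.1 / §1 ("Monach made this explicit: for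
all `N > 30` there are zeroes in `σ > 1`"; with van de Lune–te Riele for `N = 29, 30`): for every
`N ≥ 29` the Dirichlet polynomial `ζ_N(s) = ∑_{n ≤ N} n^{−s}` vanishes somewhere in the half-plane
`Re s > 1` — assembling three results of the tree:

* `TuranPartialSums_of_exists_zero_gt` (`TuranPartialSumsCertified.lean`): the range `29 ≤ N ≤ 1000` is
  certified in the kernel (Turán's power-sum criterion for `N ≤ 63`, the `σ = 1` criterion of
  [PlattTrudgian2016, §2.2] / [Montgomery1983, §2] with certified sign patterns for `64 ≤ N ≤ 1000`),
  so the barrier follows from zeros for every `N > 1000`;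
* `TuranShift.LowCert.exists_zero_re_gt_one_of_low` (`TuranPartialSumsShiftLowHolds.lean`):
  `1000 < N < 360000`, block certificates for the vertical-shift phases `p^{−iτ}`;
* `TuranShift.Cert.exists_zero_re_gt_one_of_ge` (`TuranPartialSumsShiftHolds.lean`): `N ≥ 360000`,
  the vertical-shift construction `τ = (29/4)/log N` with explicit prime bounds and certified
  interval evaluation.

Axioms: `propext`, `Classical.choice`, `Quot.sound`, plus the `native_decide` auxiliary axioms
(`Lean.ofReduceBool` / `Lean.trustCompiler`) inherited from the certified runs of the two Shift
assemblies (declared `computational` there).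

## References

* [PlattTrudgian2016] D. J. Platt, T. S. Trudgian, *Zeroes of partial sums of the zeta-function*,
  LMS J. Comput. Math. 19 (2016), 37–41: Theorem 1.1 and §1.
* [Montgomery1983] H. L. Montgomery, *Zeros of approximations to the zeta function*, in: Studies in
  Pure Mathematics to the memory of Paul Turán, Birkhäuser 1983, 497–506: §2.
* [Monach1980] W. R. Monach, *Numerical investigation of several problems in number theory*, PhD
  thesis, University of Michigan, 1980 (as reported in [PlattTrudgian2016, §1]).
-/

namespace Literature.Barriers.RiemannHypothesis

/-- **Zeros of `ζ_N` beyond `σ = 1` for every `N > 1000`**: the two vertical-shift assemblies of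
the tree, `1000 < N < 360000` (block certificates) and `N ≥ 360000` (interval certificates).
[cite: PlattTrudgian2016, §1] -/
theorem exists_zero_re_gt_one_of_gt_thousand (N : ℕ) (hN : 1000 < N) :
    ∃ s : ℂ, 1 < s.re ∧ zetaPartialSum N s = 0 := by
  rcases Nat.lt_or_ge N 360000 with h | h
  · exact TuranShift.LowCert.exists_zero_re_gt_one_of_low hN h
  · exact TuranShift.Cert.exists_zero_re_gt_one_of_ge h

/-- **`TuranPartialSums` holds** (Platt–Trudgian 2016, Theorem 1.1 with §1: Monach, van de
Lune–te Riele): for every `N ≥ 29` the section `ζ_N(s) = ∑_{n ≤ N} n^{−s}` has a zero with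
`Re s > 1` — discharge of the named fact `Literature.Barriers.RiemannHypothesis.TuranPartialSums`:
`29 ≤ N ≤ 1000` by the kernel certificates of `TuranPartialSumsCertified.lean`
(`TuranPartialSums_of_exists_zero_gt`), `N > 1000` by `exists_zero_re_gt_one_of_gt_thousand`.
[cite: PlattTrudgian2016, Theorem 1.1] [cite: Montgomery1983, §2] -/
theorem TuranPartialSums_holds : TuranPartialSums :=
  TuranPartialSums_of_exists_zero_gt exists_zero_re_gt_one_of_gt_thousand

end Literature.Barriers.RiemannHypothesis
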